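import Mathlib

/-!
# drefute gen-4 — a cheaper heart for Stub 1b (`stub_distinguishedTransferLocal`)

The registered skeleton plans to prove Stub 1b through Brauer–Nesbitt
(`Representation.nonempty_equiv_of_charpoly_eq`) applied to the two 4-dimensional SEMISIMPLE
sums of residual diagonal characters of `Γ_{ℚ_v}` — which needs `IsSemisimpleRepresentation`
instances, a `Representation.Equiv`, and then Krull–Schmidt / Hom-counting to get back to the
characters.

Observation (gen-4): in Stub 1b the four residual diagonal characters `χ̄₀, χ̄₁, χ̄₂, χ̄₃` of the
DISTINGUISHED representation `r` are PAIRWISE DISTINCT (`χ̄₀ ≠ χ̄₁`, `χ̄₂ ≠ χ̄₃` by hypothesis;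
unramified `χ̄₀, χ̄₁` differ from the `ε̄⁻¹`-type `χ̄₂, χ̄₃` on inertia because `p ≠ 2`).  For
pairwise distinct characters the TRACE congruence alone (the `X³`-coefficient of the charpoly
congruence of Stub 1a; `Matrix.trace_eq_neg_charpoly_coeff`, `Matrix.trace_mul_comm`) already
forces the residual diagonal characters `ψ̄ᵢ` of `r'` to be a PERMUTATION of the `χ̄ᵢ`, by
Dedekind's linear independence of characters (Mathlib `linearIndependent_monoidHom`) and a
counting argument that works in EVERY characteristic (a multiplicity `≡ 1 (mod p)` is non-zero;
multiplicities sum to `n` on both sides).  In particular the `ψ̄ᵢ` are pairwise distinct, which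
is exactly residual `(0,0,1,1)`-distinguishedness of `r'` in its Greenberg frame.  No
Brauer–Nesbitt, no semisimplicity bookkeeping.

This file proves the abstract algebraic lemma (any index type, any monoid, any domain):

* `MonoidHom.card_filter_eq_of_sum_eq` — multiplicities agree;
* `MonoidHom.injective_of_sum_eq` — the `ψᵢ` are pairwise distinct and each is some `χⱼ`;
* `MonoidHom.exists_perm_of_sum_eq` — `ψ = χ ∘ e` for a permutation `e`.

Positive helper for the prover of Stub 1b (evidence, not a Theorems landing).
-/

open Finset

namespace MonoidHom

variable {ι G L : Type*} [Fintype ι] [MulOneClass G] [CommRing L] [IsDomain L]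

/-- **Multiplicity comparison from a trace identity.**  If pairwise distinct monoid
homomorphisms `χ i : G →* L` (`i : ι`, `L` a domain of ANY characteristic) and arbitrary ones
`ψ i : G →* L` satisfy `∑ i, χ i g = ∑ i, ψ i g` for all `g`, then every `f : G →* L` occurs
among the `ψ i` exactly as often as among the `χ i` (i.e. `0` or `1` times). -/
theorem card_filter_eq_of_sum_eq [DecidableEq (G →* L)] (χ ψ : ι → (G →* L))
    (hχ : Function.Injective χ) (h : ∀ g, ∑ i, χ i g = ∑ i, ψ i g) (f : G →* L) :
    #{i | ψ i = f} = #{i | χ i = f} := by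
  classical
  -- the finite set of characters involved
  set S : Finset (G →* L) := univ.image χ ∪ univ.image ψ with hS
  have hχS : ∀ i ∈ (univ : Finset ι), χ i ∈ S := fun i _ => by simp [hS]
  have hψS : ∀ i ∈ (univ : Finset ι), ψ i ∈ S := fun i _ => by simp [hS]
  set a : (G →* L) → ℕ := fun f => #{i | χ i = f} with ha
  set b : (G →* L) → ℕ := fun f => #{i | ψ i = f} with hb
  -- (1) fiberwise: `∑_{f ∈ S} (a f) • f = ∑ i, χ i` and likewise for `ψ`, as functions `G → L`
  have hsumχ : ∑ f ∈ S, (a f : L) • (f : G → L) = ∑ i, (χ i : G → L) := by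
    rw [← sum_fiberwise_of_maps_to hχS]
    refine sum_congr rfl fun f _ => ?_
    rw [sum_congr rfl fun i hi => by rw [(mem_filter.1 hi).2], sum_const, ← Nat.cast_smul_eq_nsmul L]
  have hsumψ : ∑ f ∈ S, (b f : L) • (f : G → L) = ∑ i, (ψ i : G → L) := by
    rw [← sum_fiberwise_of_maps_to hψS]
    refine sum_congr rfl fun f _ => ?_
    rw [sum_congr rfl fun i hi => by rw [(mem_filter.1 hi).2], sum_const, ← Nat.cast_smul_eq_nsmul L]
  -- (2) the linear relation `∑_{f ∈ S} (a f - b f) • f = 0`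
  have hrel : ∑ f ∈ S, ((a f : L) - (b f : L)) • (f : G → L) = 0 := by
    simp only [sub_smul, sum_sub_distrib, hsumχ, hsumψ, sub_eq_zero]
    ext g
    simpa [Finset.sum_apply] using h g
  -- (3) Dedekind independence: all coefficients vanish
  have hcoef : ∀ f ∈ S, (a f : L) = (b f : L) := fun f hf =>
    sub_eq_zero.1 (linearIndependent_iff'.1 (linearIndependent_monoidHom G L) S _ hrel f hf)
  -- (4) counting: `a f ≤ 1`, `a f = 1 → b f ≠ 0`, so `a ≤ b` on `S`; sums over `S` both `= #ι`
  have ha1 : ∀ f, a f ≤ 1 := fun f =>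
    card_le_one.2 fun x hx y hy => hχ ((mem_filter.1 hx).2.trans (mem_filter.1 hy).2.symm)
  have hab : ∀ f ∈ S, a f ≤ b f := by
    intro f hf
    rcases Nat.le_one_iff_eq_zero_or_eq_one.1 (ha1 f) with h0 | h1
    · rw [h0]; exact Nat.zero_le _
    · rw [h1, Nat.one_le_iff_ne_zero]
      intro hb0
      have := hcoef f hf
      rw [h1, hb0, Nat.cast_one, Nat.cast_zero] at this
      exact one_ne_zero this
  have hsa : #(univ : Finset ι) = ∑ f ∈ S, a f := card_eq_sum_card_fiberwise hχS
  have hsb : #(univ : Finset ι) = ∑ f ∈ S, b f := card_eq_sum_card_fiberwise hψS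
  have heqS : ∀ f ∈ S, a f = b f := (sum_eq_sum_iff_of_le hab).1 (hsa.symm.trans hsb)
  -- conclusion (off `S` both multiplicities are `0`)
  by_cases hf : f ∈ S
  · exact (heqS f hf).symm
  · have hbf : b f = 0 := card_eq_zero.2 (filter_eq_empty_iff.2 fun i _ hif =>
      hf (hif ▸ hψS i (mem_univ i)))
    have haf : a f = 0 := card_eq_zero.2 (filter_eq_empty_iff.2 fun i _ hif =>
      hf (hif ▸ hχS i (mem_univ i)))
    change b f = a f
    rw [hbf, haf]

/-- **Distinct characters with the same trace sum are a rearrangement, I.**  Under the hypotheses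
of `card_filter_eq_of_sum_eq`: the `ψ i` are pairwise distinct, and each `ψ i` is some `χ j`. -/
theorem injective_of_sum_eq (χ ψ : ι → (G →* L)) (hχ : Function.Injective χ)
    (h : ∀ g, ∑ i, χ i g = ∑ i, ψ i g) :
    Function.Injective ψ ∧ ∀ i, ∃ j, ψ i = χ j := by
  classical
  have hmult := card_filter_eq_of_sum_eq χ ψ hχ h
  have hle1 : ∀ f, #{i | χ i = f} ≤ 1 := fun f =>
    card_le_one.2 fun x hx y hy => hχ ((mem_filter.1 hx).2.trans (mem_filter.1 hy).2.symm)
  refine ⟨fun i i' hii' => ?_, fun i => ?_⟩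
  · -- two indices with the same `ψ`-value would give multiplicity ≥ 2 > 1
    by_contra hne
    have h2 : 2 ≤ #{j | ψ j = ψ i} := by
      have hsub : ({i, i'} : Finset ι) ⊆ ({j | ψ j = ψ i} : Finset ι) := by
        intro x hx
        rcases mem_insert.1 hx with rfl | hx
        · simp
        · rw [mem_singleton.1 hx]; simp [hii']
      simpa [card_pair hne] using card_le_card hsub
    have := (hmult (ψ i)) ▸ h2
    exact absurd (this.trans (hle1 (ψ i))) (by norm_num)
  · -- `ψ i` occurs among the `ψ`'s, hence among the `χ`'s
    have h1 : 1 ≤ #{j | ψ j = ψ i} := card_pos.2 ⟨i, by simp⟩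
    rw [hmult (ψ i)] at h1
    obtain ⟨j, hj⟩ := card_pos.1 h1
    exact ⟨j, ((mem_filter.1 hj).2).symm⟩

/-- **Distinct characters with the same trace sum are a rearrangement, II.**  Under the hypotheses
of `card_filter_eq_of_sum_eq`, `ψ = χ ∘ e` for a permutation `e` of the index type. -/
theorem exists_perm_of_sum_eq (χ ψ : ι → (G →* L)) (hχ : Function.Injective χ)
    (h : ∀ g, ∑ i, χ i g = ∑ i, ψ i g) :
    ∃ e : Equiv.Perm ι, ∀ i, ψ i = χ (e i) := by
  classical
  obtain ⟨hψ, hex⟩ := injective_of_sum_eq χ ψ hχ h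
  choose e he using hex
  have hinj : Function.Injective e := fun i i' hii' => hψ (by rw [he i, he i', hii'])
  exact ⟨Equiv.ofBijective e (Finite.injective_iff_bijective.1 hinj), fun i => he i⟩

end MonoidHom

/-! ## The shape actually met in Stub 1b: four characters, two blocks -/

/-- **Stub 1b, algebraic core.**  Four pairwise distinct characters `χ₀, χ₁, χ₂, χ₃` (the residual
diagonal characters of the distinguished `r`: `χ̄₀ ≠ χ̄₁`, `χ̄₂ ≠ χ̄₃`, and cross-block distinct
because `p ≠ 2`) and four characters `ψ₀, …, ψ₃` (those of `r'` in its Greenberg frame) with the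
same trace: then `ψ₀ ≠ ψ₁` and `ψ₂ ≠ ψ₃` — residual distinguishedness of `r'`. -/
theorem distinguished_of_trace_eq {G L : Type*} [MulOneClass G] [CommRing L] [IsDomain L]
    (χ ψ : Fin 4 → (G →* L)) (hχ : Function.Injective χ)
    (h : ∀ g, χ 0 g + χ 1 g + χ 2 g + χ 3 g = ψ 0 g + ψ 1 g + ψ 2 g + ψ 3 g) :
    ψ 0 ≠ ψ 1 ∧ ψ 2 ≠ ψ 3 := by
  have h' : ∀ g, ∑ i, χ i g = ∑ i, ψ i g := fun g => by
    simpa [Fin.sum_univ_four] using h g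
  have hψ := (MonoidHom.injective_of_sum_eq χ ψ hχ h').1
  exact ⟨fun h01 => absurd (hψ h01) (by decide), fun h23 => absurd (hψ h23) (by decide)⟩

/-! ## The trace route (matrix side): what feeds `distinguished_of_trace_eq` in Stub 1b -/

/-- **Trace route.**  For ANY frame `g` (integral or not), the sum of the diagonal entries of
`g M g⁻¹` is minus the sub-leading coefficient of `charpoly M` — so the charpoly congruence of
Stub 1a (coefficientwise, `map_red_eq_iff_forall_norm_sub_lt_one` in the landed 1a file) gives the
congruence of the diagonal-character sums of the two triangular frames directly
(`Matrix.trace_mul_cycle` + `Matrix.trace_eq_neg_charpoly_coeff`). -/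
theorem Matrix.sum_diag_units_conj_eq_neg_charpoly_coeff {R : Type*} [CommRing R] {n : ℕ}
    (g : GL (Fin (n + 1)) R) (M : Matrix (Fin (n + 1)) (Fin (n + 1)) R) :
    ∑ i, ((g : Matrix (Fin (n + 1)) (Fin (n + 1)) R) * M *
        ((g⁻¹ : GL (Fin (n + 1)) R) : Matrix (Fin (n + 1)) (Fin (n + 1)) R)) i i =
      -(M.charpoly.coeff n) := by
  have h1 : ((g : Matrix (Fin (n + 1)) (Fin (n + 1)) R) * M *
      ((g⁻¹ : GL (Fin (n + 1)) R) : Matrix (Fin (n + 1)) (Fin (n + 1)) R)).trace = M.trace := by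
    rw [Matrix.trace_mul_cycle, Units.inv_mul, one_mul]
  have h2 := Matrix.trace_eq_neg_charpoly_coeff M
  rw [Fintype.card_fin, Nat.add_sub_cancel] at h2
  rw [← h2, ← h1, Matrix.trace]
  rfl

/-- The `4 × 4` instance used by Stub 1b: `∑ᵢ (g M g⁻¹)ᵢᵢ = -(charpoly M).coeff 3`. -/
example {R : Type*} [CommRing R] (g : GL (Fin 4) R) (M : Matrix (Fin 4) (Fin 4) R) :
    ∑ i, ((g : Matrix (Fin 4) (Fin 4) R) * M * ((g⁻¹ : GL (Fin 4) R) : Matrix (Fin 4) (Fin 4) R)) i i =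
      -(M.charpoly.coeff 3) :=
  Matrix.sum_diag_units_conj_eq_neg_charpoly_coeff g M
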